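import Literature.NumberTheory.EllipticCurves.IwasawaAlgebraCharIdealTwoSidedSandwichProofs
import HarnessLib

/-!
# The two-sided sandwich with HEIGHT-TWO IDEALS instead of prime pairs: `J₁·I_A ⊆ I_B`, `ϖ^k·J₂·I_B ⊆ I_A` with `R/J₁`, `R/J₂` pseudo-null ⟹
# `∃ i i′, char(R/I_B)·(ϖ)^i = char(R/I_A)·(ϖ)^{i′}` — so that PRODUCTS of height-two ideals (e.g. the augmentation ideal times a liftable pair) can be used

Generic commutative algebra (everything PROVED, nothing assumed), continuing `IwasawaAlgebraCharIdealTwoSidedSandwichProofs` (prime-pair form) and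
`IwasawaAlgebraPseudoNullPrimePairProofs` (`(f, g)·A ⊆ B ⟹ char(N/B) = char(N/(A ⊔ B))`).  A module killed by an ideal `J` with `R/J` pseudo-null is
pseudo-null (the pointwise criterion `Module.isPseudoNull_iff`); hence `J·A ⊆ B ⟹ char(N/B) = char(N/(A ⊔ B))` for finitely generated torsion `N/B`, and the
two-sided sandwich follows exactly as in the prime-pair form.  Products: if `R/J`, `R/J'` are pseudo-null so is `R/(J·J')` (`isPseudoNull_quotient_mul`), which is
what makes the ideal form composable (the prime-pair form is not: `(f,g)·(f',g')` contains no obvious prime pair).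

* ★ `Module.isPseudoNull_of_forall_smul_eq_zero` — `J·M = 0`, `R/J` pseudo-null ⟹ `M` pseudo-null;
* `Module.isPseudoNull_quotient_mul` — `R/J`, `R/J'` pseudo-null ⟹ `R/(J·J')` pseudo-null; `Module.isPseudoNull_quotient_span_pair` (a prime pair `f ∤ g` gives one);
* ★★ `Module.charIdeal_quotient_eq_of_ideal_smul_le` — `J·A ⊆ B` ⟹ **`char(N/B) = char(N/(A ⊔ B))`**;
* ★★★ `Module.exists_charIdeal_quotient_mul_span_pow_eq_of_ideal_sandwich` — THE IDEAL SANDWICH.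

USE (cell `bsd-print-cf2`, width seat `bsd-line-cf2c-w7` g26, brick §4(c), item D4χ, memo `Cruxes/TwoVariableMainConjAtSplitTwoQuad/BRICK-C-D4CHI-g26.md` §2 (P1)):
the liftable ideals `𝔞` with `3 ∣ 𝔞` enter `A_χ` only through the product rule `(σ̃_𝔠 − N𝔠)·y(𝔞) = (σ̃_𝔞 − N𝔞)·y(𝔠)`, so the first containment holds for the
PRODUCT of the augmentation ideal `(T, X)` and a liftable pair `J'` — a height-two ideal without an obvious prime pair.  `--supports` crux stmt-BirchSwinnertonDyer-24033.
BSD is not advanced by this file.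

References: E. de Shalit, *Iwasawa theory of elliptic curves with complex multiplication* (1987), II §4.12 (29)–(32), III §1.4 (5), Lemma 1.10 (17);
N. Bourbaki, *Algèbre commutative* VII §4 no. 4–5; J. Neukirch, A. Schmidt, K. Wingberg, *Cohomology of Number Fields* (2nd ed.) Ch. V §1 (5.1.4)–(5.1.6).
-/

noncomputable section

namespace Literature.NumberTheory.EllipticCurves

namespace Module

variable {R : Type*} [CommRing R] [IsNoetherianRing R] [IsDomain R]
  {M : Type*} [AddCommGroup M] [_root_.Module R M]
  {N : Type*} [AddCommGroup N] [_root_.Module R N]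

/-! ### Modules killed by a height-two ideal -/

omit [IsNoetherianRing R] [IsDomain R] in
/-- ★ **A module killed by an ideal `J` with `R/J` pseudo-null is pseudo-null**: for `𝔭` of height `≤ 1` some `s ∈ J` lies outside `𝔭` (it kills `1 ∈ R/J`
after localisation), and `s·M = 0`. [cite: BourbakiAC5to7, Ch. VII §4 no. 4] [cite: deShalit1987, III Lemma 1.10 (p. 95)] -/
theorem isPseudoNull_of_forall_smul_eq_zero {J : Ideal R} (hJ : IsPseudoNull R (R ⧸ J)) (hM : ∀ a ∈ J, ∀ m : M, a • m = 0) : IsPseudoNull R M := by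
  rw [isPseudoNull_iff] at hJ ⊢
  intro 𝔭 h𝔭 m
  obtain ⟨s, hs, hs1⟩ := hJ 𝔭 h𝔭 (Ideal.Quotient.mk J 1)
  refine ⟨s, hs, hM s ?_ m⟩
  rw [Algebra.smul_def, Ideal.Quotient.algebraMap_eq, ← map_mul, mul_one, Ideal.Quotient.eq_zero_iff_mem] at hs1
  exact hs1

omit [IsNoetherianRing R] [IsDomain R] in
/-- **`R/(J·J')` is pseudo-null when `R/J` and `R/J'` are** (pick `s ∈ J`, `s' ∈ J'` outside `𝔭`; then `ss' ∈ J·J'` is outside `𝔭`).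
[cite: BourbakiAC5to7, Ch. VII §4 no. 4] -/
theorem isPseudoNull_quotient_mul {J J' : Ideal R} (hJ : IsPseudoNull R (R ⧸ J)) (hJ' : IsPseudoNull R (R ⧸ J')) : IsPseudoNull R (R ⧸ J * J') := by
  rw [isPseudoNull_iff] at hJ hJ' ⊢
  intro 𝔭 h𝔭 m
  obtain ⟨s, hs, hs1⟩ := hJ 𝔭 h𝔭 (Ideal.Quotient.mk J 1)
  obtain ⟨s', hs', hs'1⟩ := hJ' 𝔭 h𝔭 (Ideal.Quotient.mk J' 1)
  rw [Algebra.smul_def, Ideal.Quotient.algebraMap_eq, ← map_mul, mul_one, Ideal.Quotient.eq_zero_iff_mem] at hs1 hs'1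
  obtain ⟨z, rfl⟩ := Ideal.Quotient.mk_surjective m
  refine ⟨s * s', Submonoid.mul_mem _ hs hs', ?_⟩
  rw [Algebra.smul_def, Ideal.Quotient.algebraMap_eq, ← map_mul, Ideal.Quotient.eq_zero_iff_mem]
  exact Ideal.mul_mem_right z _ (Ideal.mul_mem_mul hs1 hs'1)

omit [IsNoetherianRing R] in
/-- A prime pair gives a height-two ideal: `R/(f, g)` is pseudo-null for `f` prime, `f ∤ g`. [cite: deShalit1987, III Lemma 1.10 (p. 95)] -/
theorem isPseudoNull_quotient_span_pair {f g : R} (hf : Prime f) (hfg : ¬ f ∣ g) : IsPseudoNull R (R ⧸ Ideal.span {f, g}) := by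
  refine isPseudoNull_of_isTorsionBy_prime_of_not_dvd hf hfg (fun x ↦ ?_) (fun x ↦ ?_)
  · obtain ⟨z, rfl⟩ := Ideal.Quotient.mk_surjective x
    rw [Algebra.smul_def, Ideal.Quotient.algebraMap_eq, ← map_mul, Ideal.Quotient.eq_zero_iff_mem]
    exact Ideal.mul_mem_right z _ (Ideal.subset_span (by simp))
  · obtain ⟨z, rfl⟩ := Ideal.Quotient.mk_surjective x
    rw [Algebra.smul_def, Ideal.Quotient.algebraMap_eq, ← map_mul, Ideal.Quotient.eq_zero_iff_mem]
    exact Ideal.mul_mem_right z _ (Ideal.subset_span (by simp))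

/-! ### `J·A ⊆ B ⟹ char(N/B) = char(N/(A ⊔ B))` -/

/-- ★★ **`char(N ⧸ B) = char(N ⧸ (A ⊔ B))` when `J·A ⊆ B`** for an ideal `J` with `R/J` pseudo-null (`N ⧸ B` finitely generated torsion): `(A ⊔ B)/B` is killed by `J`,
hence pseudo-null. [cite: deShalit1987, III §1.4 (5), Lemma 1.10] [cite: BourbakiAC5to7, Ch. VII §4 no. 5] -/
theorem charIdeal_quotient_eq_of_ideal_smul_le (A B : Submodule R N) [Module.Finite R (N ⧸ B)] (hB : Module.IsTorsion R (N ⧸ B))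
    {J : Ideal R} (hJ : IsPseudoNull R (R ⧸ J)) (hJA : ∀ s ∈ J, ∀ a ∈ A, s • a ∈ B) :
    charIdeal R (N ⧸ B) = charIdeal R (N ⧸ (A ⊔ B)) := by
  have hPN : IsPseudoNull R ↥((A ⊔ B).map B.mkQ) :=
    isPseudoNull_of_forall_smul_eq_zero hJ fun s hs x ↦ by
      have h := isTorsionBy_map_mkQ_sup_of_smul_mem A B (hJA s hs)
      exact h (x := x)
  rw [← charIdeal_quotient_mul_charIdeal_quotient_map B (A ⊔ B) le_sup_right hB, charIdeal_eq_top_of_isPseudoNull hPN, Ideal.top_mul]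

/-! ### The ideal sandwich -/

omit [IsNoetherianRing R] in
/-- A height-two ideal of a domain is non-zero (`R/0 ≅ R` is not pseudo-null). [cite: BourbakiAC5to7, Ch. VII §4 no. 4] -/
theorem ne_bot_of_isPseudoNull_quotient {J : Ideal R} (hJ : IsPseudoNull R (R ⧸ J)) : J ≠ ⊥ := by
  rintro rfl
  exact not_isPseudoNull_self (R := R)
    (hJ.of_linearEquiv ((Submodule.quotEquivOfEqBot (⊥ : Submodule R R) rfl)))

/-- ★★★ **THE IDEAL SANDWICH.**  `R` a Noetherian domain, `ϖ` prime, `J₁`, `J₂` ideals with `R/J₁`, `R/J₂` pseudo-null; ideals `I_A`, `I_B` with `J₁·I_A ⊆ I_B` and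
`ϖ^k·J₂·I_B ⊆ I_A`.  Then **`∃ i i′, char(R ⧸ I_B)·(ϖ)^i = char(R ⧸ I_A)·(ϖ)^{i′}`**. [cite: deShalit1987, III §1.4 (5), Lemma 1.10 (17)]
[cite: BourbakiAC5to7, Ch. VII §4 no. 5 Prop. 10–11] [cite: NeukirchSchmidtWingberg2008, Ch. V §3 (5.3.9)–(5.3.10)] -/
theorem exists_charIdeal_quotient_mul_span_pow_eq_of_ideal_sandwich (I_A I_B J₁ J₂ : Ideal R) {ϖ : R} (k : ℕ) (hϖ : Prime ϖ)
    (hJ₁ : IsPseudoNull R (R ⧸ J₁)) (hJ₂ : IsPseudoNull R (R ⧸ J₂)) (h₁ : J₁ * I_A ≤ I_B) (h₂ : Ideal.span {ϖ ^ k} * J₂ * I_B ≤ I_A) :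
    ∃ i i' : ℕ, charIdeal R (R ⧸ I_B) * Ideal.span {ϖ} ^ i = charIdeal R (R ⧸ I_A) * Ideal.span {ϖ} ^ i' := by
  by_cases hA : I_A = ⊥
  · -- then `I_B = ⊥` too: `ϖ^k j b ∈ I_A = 0` for `j ∈ J₂ ∖ 0`
    obtain ⟨j, hjJ, hj0⟩ := J₂.ne_bot_iff.mp (ne_bot_of_isPseudoNull_quotient hJ₂)
    have hB : I_B = ⊥ := by
      rw [Submodule.eq_bot_iff]
      intro b hb
      have hmem : ϖ ^ k * j * b ∈ I_A := h₂ (Ideal.mul_mem_mul (Ideal.mul_mem_mul (Ideal.mem_span_singleton_self _) hjJ) hb)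
      rw [hA, Ideal.mem_bot, mul_eq_zero, mul_eq_zero] at hmem
      rcases hmem with (h | h) | h
      · exact absurd h (pow_ne_zero k hϖ.ne_zero)
      · exact absurd h hj0
      · exact h
    subst hA; subst hB
    exact ⟨0, 0, rfl⟩
  · have hB : I_B ≠ ⊥ := by
      obtain ⟨a, haI, ha0⟩ := I_A.ne_bot_iff.mp hA
      obtain ⟨j, hjJ, hj0⟩ := J₁.ne_bot_iff.mp (ne_bot_of_isPseudoNull_quotient hJ₁)
      exact I_B.ne_bot_iff.mpr ⟨j * a, h₁ (Ideal.mul_mem_mul hjJ haI), mul_ne_zero hj0 ha0⟩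
    have htB : Module.IsTorsion R (R ⧸ I_B) := isTorsion_quotient_of_ne_bot hB
    have htA : Module.IsTorsion R (R ⧸ I_A) := isTorsion_quotient_of_ne_bot hA
    -- (1) `char(R/I_B) = char(R/(I_A ⊔ I_B))`
    have h1 : charIdeal R (R ⧸ I_B) = charIdeal R (R ⧸ (I_A ⊔ I_B)) :=
      charIdeal_quotient_eq_of_ideal_smul_le I_A I_B htB hJ₁ fun s hs a ha ↦ h₁ (Ideal.mul_mem_mul hs ha)
    -- (2) slack between `A′ := I_A ⊔ (ϖ^k)·I_B` and `I_A ⊔ I_B`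
    set A' : Ideal R := I_A ⊔ Ideal.span {ϖ ^ k} * I_B with hA'def
    have hle : A' ≤ I_A ⊔ I_B := sup_le le_sup_left (Ideal.mul_le_left.trans le_sup_right)
    have hA'ne : A' ≠ ⊥ := fun h ↦ hA (le_bot_iff.mp (le_sup_left.trans h.le))
    have htA' : Module.IsTorsion R (R ⧸ A') := isTorsion_quotient_of_ne_bot hA'ne
    have hsm : ∀ a ∈ I_A ⊔ I_B, ϖ ^ k • a ∈ A' := by
      intro a ha
      obtain ⟨x, hx, y, hy, rfl⟩ := Submodule.mem_sup.mp ha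
      rw [smul_add]
      exact Submodule.add_mem _ (Submodule.mem_sup_left (I_A.smul_mem _ hx))
        (Submodule.mem_sup_right (Ideal.mem_span_singleton_mul.mpr ⟨y, hy, rfl⟩))
    obtain ⟨i, i', h2⟩ := exists_charIdeal_quotient_mul_span_pow_eq_of_smul_le A' (I_A ⊔ I_B) hle htA' hϖ hsm
    -- (3) `char(R/I_A) = char(R/((ϖ^k)·I_B ⊔ I_A)) = char(R/A′)` (pair `J₂`)
    have h3 : charIdeal R (R ⧸ I_A) = charIdeal R (R ⧸ A') := by
      rw [hA'def, sup_comm]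
      refine charIdeal_quotient_eq_of_ideal_smul_le (Ideal.span {ϖ ^ k} * I_B) I_A htA hJ₂ fun s hs a ha ↦ ?_
      obtain ⟨b, hb, rfl⟩ := Ideal.mem_span_singleton_mul.mp ha
      have e : s • (ϖ ^ k * b) = ϖ ^ k * s * b := by rw [smul_eq_mul]; ring
      rw [e]
      exact h₂ (Ideal.mul_mem_mul (Ideal.mul_mem_mul (Ideal.mem_span_singleton_self _) hs) hb)
    exact ⟨i', i, by rw [h1, ← h2, ← h3]⟩

end Module

end Literature.NumberTheory.EllipticCurves

end
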